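import Literature.AlgebraicGeometry.HodgeTheory.HypersurfaceLefschetzUpper
import Literature.AlgebraicGeometry.HodgeTheory.BettiUniverseAxioms
import Literature.AlgebraicGeometry.Motives.ComplexPointsOrientation
import Literature.AlgebraicGeometry.Motives.VarietiesProperProofs
import Literature.NumberTheory.Transcendental.RoySmallValueFactors
import Literature.Topology.FourManifolds.ComplexProjectiveSpaceHomologyProofs
import HarnessLib

/-!
# A smooth variety cut out by a form is a smooth hypersurface of an irreducible factor; Lefschetz
# consequences for `IsHypersurfaceCutOutBy` (off-middle classes algebraic, odd Betti numbers vanish)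

Family `hodge`, layer `Literature/AlgebraicGeometry/HodgeTheory`. Written by the cross-ladder
literature-typing seat `littype-FH1-2` (cell `hodge-nonav`) for crux K2 `PowersHodgeOfSignCommutators`
of the route `HodgeConjecture/SignSymmetricPowers` (and the route of record `CyclicUnitaryPowers`),
whose typed statements present the threefold as `IsSmoothProjective 3 X ∧ IsHypersurfaceCutOutBy 4 f X`
for a form `f` that is NOT assumed irreducible, while the tree's Lefschetz theorems for hypersurfaces
(`Voisin2003_smoothHypersurface_algebraicClasses_eq_top_holds`, `surjective_map_of_lt`,
`HypersurfaceLefschetzUpper`) are stated for `Motives.IsSmoothHypersurface n d X`, i.e. with an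
IRREDUCIBLE defining form. The cell's K2 assembly map (§2 (G2), "weak Lefschetz for
`IsHypersurfaceCutOutBy 4 f X` in degrees `≠ 3`", listed among the "facts to request from littype if
missing") needs the bridge; this file proves it and draws the consequences.

## Contents (everything PROVED; no definition, no named fact — D-0026)

§1 **Irreducible zero loci come from irreducible factors** (Hartshorne I Ex. 2.9 / II Ex. 2.9 / I
   Prop. 1.13: irreducible hypersurfaces of `ℙᴺ` ↔ irreducible forms; here only the easy half, over
   any field `K`): if `f ≠ 0` and `V₊(f) ⊆ ℙⁿ⁺¹_K` is irreducible, then `V₊(f) = V₊(g)` for an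
   irreducible factor `g ∣ f` (`exists_irreducible_dvd_zeroLocus_eq`; unique factorisation,
   `V₊(pa) = V₊(p) ∪ V₊(a)`, and an irreducible set contained in a union of two closed sets lies in
   one of them); divisors of non-zero forms are forms (the tree's `Roy2013.isHomogeneous_of_dvd`) of
   positive degree when irreducible. Hence **a reduced irreducible `X` cut out by `f ≠ 0` is cut out
   by an irreducible form dividing `f`** (`IsHypersurfaceCutOutBy.exists_irreducible`) and **a smooth
   projective `X` of dimension `n` cut out in `ℙⁿ⁺¹` by a non-zero form is a smooth hypersurface**
   `IsSmoothHypersurface n d' X` for some `d' ≥ 1` (`IsSmoothProjective.exists_isSmoothHypersurface`).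
§2 **Lefschetz for `IsHypersurfaceCutOutBy`** (over `ℂ`; Voisin II Thm. 1.23, Cor. 1.24–1.25, as
   PROVED in the tree for `IsSmoothHypersurface`): for `X` smooth projective of dimension `n` cut out
   in `ℙⁿ⁺¹` by a non-zero form — `algebraicClasses X p = ⊤` for `2p ≠ n`
   (`algebraicClasses_eq_top_of_isHypersurfaceCutOutBy`); `Hᵏ(X(ℂ); ℂ) = 0` for `k` odd, `k ≠ n`
   (`subsingleton_complexBetti_of_odd`: below the middle by Lefschetz surjectivity from
   `Hᵏ(ℙⁿ⁺¹(ℂ); ℂ) = 0`, Hatcher Thm. 2.35 (iii); above it by Poincaré duality, Hatcher Cor. 3.37);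
   the same for `Hᵏ(X(ℂ); ℚ)` (`subsingleton_bettiCohomology_of_odd`, universal coefficients
   `ℂ ⊗_ℚ Hᵏ(X(ℂ); ℚ) ≅ Hᵏ(X(ℂ); ℂ)`); and the threefold instances used by K2:
   `H¹(X(ℂ); ℚ) = 0 = H⁵(X(ℂ); ℚ)` and all even-degree classes algebraic
   (`subsingleton_bettiCohomology_one_and_five_threefold`, `algebraicClasses_eq_top_threefold`).

The hypothesis `f ≠ 0` is kept explicit (for `f = 0`, `V₊(f) = ℙⁿ⁺¹` and no `X` of dimension `n` is
cut out by it, but that exclusion is dimension theory, not needed by the consumers, who know `f ≠ 0`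
from its degree `d ≥ 4` and the Hodge numbers of `X`).

## References

* [Hartshorne1977] R. Hartshorne, Algebraic Geometry, GTM 52 (1977), I Prop. 1.13, I Ex. 2.9,
  II Ex. 2.9, II Ex. 3.11 (d).
* [VoisinHodgeII2003] C. Voisin, Hodge Theory and Complex Algebraic Geometry II, CUP 2003, §1.2.2
  Thm. 1.23, §1.2.3 Cor. 1.24–1.25.
* [HatcherAT2002] A. Hatcher, Algebraic Topology, CUP 2002, §2.2 Thm. 2.35 (iii), §3.1 Thm. 3.2,
  §3.3 Cor. 3.37.
-/

noncomputable section

open CategoryTheory AlgebraicGeometry MvPolynomial Module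
open scoped TensorProduct
open Literature.AlgebraicTopology.SingularHomology
open Literature.AlgebraicGeometry.Motives

universe u

namespace Literature.AlgebraicGeometry.HodgeTheory

/-! ### §1 Irreducible zero loci and irreducible factors -/

section CutOut

variable {K : Type u} [Field K] {n : ℕ}

/-- `V₊(u) = ∅` for a unit `u` (no relevant prime contains a unit). [folklore] -/
private theorem zeroLocus_singleton_eq_empty_of_isUnit {u : MvPolynomial (Fin (n + 2)) K}
    (hu : IsUnit u) :
    letI := MvPolynomial.gradedAlgebra (σ := Fin (n + 2)) (R := K);
    ProjectiveSpectrum.zeroLocus (MvPolynomial.homogeneousSubmodule (Fin (n + 2)) K) {u} = ∅ := by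
  letI := MvPolynomial.gradedAlgebra (σ := Fin (n + 2)) (R := K)
  ext p
  simp only [Set.mem_empty_iff_false, iff_false]
  intro hp
  rw [ProjectiveSpectrum.mem_zeroLocus, Set.singleton_subset_iff, SetLike.mem_coe] at hp
  exact p.isPrime.ne_top (Ideal.eq_top_of_isUnit_mem _ hp hu)

/-- **An irreducible zero locus is the zero locus of an irreducible factor** (Hartshorne I Ex. 2.9 /
II Ex. 2.9, easy half): for `f ≠ 0` in `K[x₀, …, x_{n+1}]` with `V₊(f)` irreducible there is an
irreducible `g ∣ f` with `V₊(g) = V₊(f)`. Unique factorisation: `V₊(pa) = V₊(p) ∪ V₊(a)` and an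
irreducible set inside a union of two closed sets lies inside one of them. [cite: Hartshorne1977, I Ex. 2.9 and II Ex. 2.9] -/
theorem exists_irreducible_dvd_zeroLocus_eq (f : MvPolynomial (Fin (n + 2)) K) (hf0 : f ≠ 0)
    (hirr : letI := MvPolynomial.gradedAlgebra (σ := Fin (n + 2)) (R := K);
      IsIrreducible (ProjectiveSpectrum.zeroLocus (MvPolynomial.homogeneousSubmodule (Fin (n + 2)) K) {f})) :
    ∃ g : MvPolynomial (Fin (n + 2)) K, Irreducible g ∧ g ∣ f ∧
      letI := MvPolynomial.gradedAlgebra (σ := Fin (n + 2)) (R := K);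
      ProjectiveSpectrum.zeroLocus (MvPolynomial.homogeneousSubmodule (Fin (n + 2)) K) {g} =
        ProjectiveSpectrum.zeroLocus (MvPolynomial.homogeneousSubmodule (Fin (n + 2)) K) {f} := by
  letI := MvPolynomial.gradedAlgebra (σ := Fin (n + 2)) (R := K)
  induction f using UniqueFactorizationMonoid.induction_on_prime with
  | h₁ => exact absurd rfl hf0
  | h₂ u hu =>
    have he := zeroLocus_singleton_eq_empty_of_isUnit (n := n) hu
    rw [he] at hirr
    exact absurd hirr.nonempty Set.not_nonempty_empty
  | h₃ a p ha hp ih =>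
    have hunion : ProjectiveSpectrum.zeroLocus (MvPolynomial.homogeneousSubmodule (Fin (n + 2)) K)
        {p * a} = ProjectiveSpectrum.zeroLocus _ {p} ∪ ProjectiveSpectrum.zeroLocus _ {a} :=
      ProjectiveSpectrum.zeroLocus_singleton_mul _ p a
    rcases isPreirreducible_iff_isClosed_union_isClosed.mp hirr.isPreirreducible _ _
        (ProjectiveSpectrum.isClosed_zeroLocus _ _) (ProjectiveSpectrum.isClosed_zeroLocus _ _)
        hunion.le with h | h
    · exact ⟨p, hp.irreducible, dvd_mul_right p a,
        le_antisymm (hunion ▸ Set.subset_union_left) h⟩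
    · have hVa : ProjectiveSpectrum.zeroLocus (MvPolynomial.homogeneousSubmodule (Fin (n + 2)) K) {a} =
          ProjectiveSpectrum.zeroLocus _ {p * a} :=
        le_antisymm (hunion ▸ Set.subset_union_right) h
      obtain ⟨g, hg, hga, hVg⟩ := ih ha (hVa ▸ hirr)
      exact ⟨g, hg, hga.trans (dvd_mul_left a p), hVg.trans hVa⟩

/-- An irreducible polynomial has positive total degree (a constant is `0` or a unit). [folklore] -/
private theorem one_le_totalDegree_of_irreducible {σ : Type*} {g : MvPolynomial σ K} (hg : Irreducible g) :
    1 ≤ g.totalDegree := by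
  by_contra hlt
  have h0 : g.totalDegree = 0 := by omega
  rw [totalDegree_eq_zero_iff_eq_C] at h0
  have hc : g.coeff 0 ≠ 0 := by
    intro hc
    apply hg.ne_zero
    rw [h0, hc, map_zero]
  exact hg.not_isUnit (h0 ▸ (Ne.isUnit hc).map C)

/-- **A reduced irreducible scheme cut out by a non-zero form is cut out by an irreducible factor of
it** (Hartshorne I Ex. 2.9 / II Ex. 2.9: the image `V₊(f)` of the irreducible `X` is irreducible).
[cite: Hartshorne1977, I Ex. 2.9 and II Ex. 2.9] -/
theorem _root_.Literature.AlgebraicGeometry.Motives.IsHypersurfaceCutOutBy.exists_irreducible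
    {X : SchemeOver K} [IrreducibleSpace X.left] {f : MvPolynomial (Fin (n + 2)) K}
    (h : IsHypersurfaceCutOutBy (n + 1) f X) (hf0 : f ≠ 0) :
    ∃ g : MvPolynomial (Fin (n + 2)) K, Irreducible g ∧ g ∣ f ∧ IsHypersurfaceCutOutBy (n + 1) g X := by
  letI := MvPolynomial.gradedAlgebra (σ := Fin (n + 2)) (R := K)
  obtain ⟨hred, ι, hι, hrange⟩ := h
  have hirr : IsIrreducible (ProjectiveSpectrum.zeroLocus
      (MvPolynomial.homogeneousSubmodule (Fin (n + 2)) K) {f}) := by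
    rw [← hrange, ← Set.image_univ]
    exact (IrreducibleSpace.isIrreducible_univ _).image _ ι.left.continuous.continuousOn
  obtain ⟨g, hg, hgf, hV⟩ := exists_irreducible_dvd_zeroLocus_eq f hf0 hirr
  exact ⟨g, hg, hgf, hred, ι, hι, hrange.trans hV.symm⟩

/-- With `f` homogeneous the irreducible factor is a form of positive degree.
[cite: Hartshorne1977, I Ex. 2.9 and II Ex. 2.9] -/
theorem _root_.Literature.AlgebraicGeometry.Motives.IsHypersurfaceCutOutBy.exists_irreducible_isHomogeneous
    {X : SchemeOver K} [IrreducibleSpace X.left] {f : MvPolynomial (Fin (n + 2)) K} {d : ℕ}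
    (h : IsHypersurfaceCutOutBy (n + 1) f X) (hf : f.IsHomogeneous d) (hf0 : f ≠ 0) :
    ∃ (g : MvPolynomial (Fin (n + 2)) K) (d' : ℕ), 1 ≤ d' ∧ g.IsHomogeneous d' ∧ Irreducible g ∧
      g ∣ f ∧ IsHypersurfaceCutOutBy (n + 1) g X := by
  obtain ⟨g, hg, hgf, hcut⟩ := h.exists_irreducible hf0
  exact ⟨g, g.totalDegree, one_le_totalDegree_of_irreducible hg,
    Literature.NumberTheory.Transcendental.Roy2013.isHomogeneous_of_dvd hf hf0 hgf, hg, hgf, hcut⟩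

/-- **A smooth projective variety of dimension `n` cut out in `ℙⁿ⁺¹` by a non-zero form is a smooth
hypersurface** in the tree's sense `IsSmoothHypersurface n d' X` (cut out by an IRREDUCIBLE form of
some degree `d' ≥ 1`): `X` is irreducible (geometrically irreducible over the point `Spec K`), so
`V₊(f) = V₊(g)` for an irreducible factor `g` of `f`. [cite: Hartshorne1977, I Ex. 2.9 and II Ex. 2.9] -/
theorem _root_.Literature.AlgebraicGeometry.Motives.IsSmoothProjective.exists_isSmoothHypersurface
    {X : SchemeOver K} (hX : IsSmoothProjective n X) {f : MvPolynomial (Fin (n + 2)) K} {d : ℕ}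
    (hf : f.IsHomogeneous d) (hf0 : f ≠ 0) (h : IsHypersurfaceCutOutBy (n + 1) f X) :
    ∃ d' : ℕ, 1 ≤ d' ∧ IsSmoothHypersurface n d' X := by
  haveI := hX.geometricallyIrreducible
  haveI : IrreducibleSpace ↥X.left := GeometricallyIrreducible.irreducibleSpace_of_subsingleton X.hom
  obtain ⟨g, d', hd', hghom, hg, -, hcut⟩ := h.exists_irreducible_isHomogeneous hf hf0
  exact ⟨d', hd', hX, g, hghom, hg, hcut⟩

/-- The same keeping the divisibility datum: `X` is cut out by an irreducible form `g ∣ f` of degree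
`d' ≥ 1`. [cite: Hartshorne1977, I Ex. 2.9 and II Ex. 2.9] -/
theorem _root_.Literature.AlgebraicGeometry.Motives.IsSmoothProjective.exists_irreducible_dvd_isHypersurfaceCutOutBy
    {X : SchemeOver K} (hX : IsSmoothProjective n X) {f : MvPolynomial (Fin (n + 2)) K} {d : ℕ}
    (hf : f.IsHomogeneous d) (hf0 : f ≠ 0) (h : IsHypersurfaceCutOutBy (n + 1) f X) :
    ∃ (g : MvPolynomial (Fin (n + 2)) K) (d' : ℕ), 1 ≤ d' ∧ g.IsHomogeneous d' ∧ Irreducible g ∧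
      g ∣ f ∧ IsHypersurfaceCutOutBy (n + 1) g X := by
  haveI := hX.geometricallyIrreducible
  haveI : IrreducibleSpace ↥X.left := GeometricallyIrreducible.irreducibleSpace_of_subsingleton X.hom
  exact h.exists_irreducible_isHomogeneous hf hf0

end CutOut

/-! ### §2 Lefschetz consequences over `ℂ` -/

section HodgeTheory

variable {n d : ℕ} {X : SchemeOver ℂ} {f : MvPolynomial (Fin (n + 2)) ℂ}

/-- **Off the middle degree every class is algebraic** on a smooth projective `X` of dimension `n`
cut out in `ℙⁿ⁺¹_ℂ` by a non-zero form: `algebraicClasses X p = ⊤` for `2p ≠ n` (Voisin II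
Cor. 1.24–1.25; the tree's discharged fact `Voisin2003_smoothHypersurface_algebraicClasses_eq_top_holds`
through `IsSmoothProjective.exists_isSmoothHypersurface`). [cite: VoisinHodgeII2003, §1.2.3 Cor. 1.24 and Cor. 1.25] -/
theorem algebraicClasses_eq_top_of_isHypersurfaceCutOutBy (hX : IsSmoothProjective n X)
    (hf : f.IsHomogeneous d) (hf0 : f ≠ 0) (h : IsHypersurfaceCutOutBy (n + 1) f X) {p : ℕ}
    (hp : 2 * p ≠ n) : algebraicClasses X p = ⊤ := by
  obtain ⟨d', -, hY⟩ := hX.exists_isSmoothHypersurface hf hf0 h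
  exact Voisin2003_smoothHypersurface_algebraicClasses_eq_top_holds.of_two_mul_ne hY p hp

/-- `Hʲ(ℙᴺ(ℂ); ℂ) = 0` for odd `j` (`Hⱼ(ℂℙᴺ) = 0`, Hatcher Thm. 2.35 (iii), universal coefficients
over a field); re-derived here to keep the Fermat files out of the import cone (same statement as
`subsingleton_complexBetti_projectiveSpace_of_odd` of `FermatOddDegreeRestriction`).
[cite: HatcherAT2002, §2.2 Thm. 2.35 (iii) and §3.1 Thm. 3.2] -/
private theorem subsingleton_complexBetti_projectiveSpace_of_odd' (N : ℕ) {j : ℕ} (hj : Odd j) :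
    Subsingleton (complexBetti (projectiveSpace N ℂ) j) := by
  have hz := (Literature.Topology.FourManifolds.singularHomology_complexProjectiveSpace_of_module
    ℂ ℂ N j).2 (fun h ↦ (Nat.not_even_iff_odd.mpr hj) h.1)
  haveI := ModuleCat.subsingleton_of_isZero hz
  haveI : Subsingleton (singularCohomology ℂ ℂ
      (Literature.Topology.FourManifolds.ComplexProjectiveSpace N) j) :=
    (kroneckerPairing_injective_of_field ℂ
      (Literature.Topology.FourManifolds.ComplexProjectiveSpace N) j).subsingleton
  exact (singularCohomology.mapIso ℂ ℂ
    (complexPointsProjectiveSpaceHomeomorph N) j).toLinearEquiv.toEquiv.symm.subsingleton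

/-- **Odd cohomology below the middle vanishes**: `Hᵏ(X(ℂ); ℂ) = 0` for `k` odd, `k < n`, on a smooth
projective `X` of dimension `n` cut out in `ℙⁿ⁺¹_ℂ` by a non-zero form — Lefschetz surjectivity
`Hᵏ(ℙⁿ⁺¹(ℂ)) ↠ Hᵏ(X(ℂ))` (Voisin II Thm. 1.23, the tree's `surjective_map_of_lt`) from a zero group.
[cite: VoisinHodgeII2003, §1.2.2 Thm. 1.23] [cite: HatcherAT2002, §2.2 Thm. 2.35 (iii)] -/
theorem subsingleton_complexBetti_of_odd_of_lt (hX : IsSmoothProjective n X) (hf : f.IsHomogeneous d)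
    (hf0 : f ≠ 0) (h : IsHypersurfaceCutOutBy (n + 1) f X) {k : ℕ} (hk : Odd k) (hkn : k < n) :
    Subsingleton (complexBetti X k) := by
  obtain ⟨d', -, hY⟩ := hX.exists_isSmoothHypersurface hf hf0 h
  obtain ⟨F, hFhom, hFirr, _, ι, hι, hrange⟩ := hY.2
  haveI := hι
  haveI := subsingleton_complexBetti_projectiveSpace_of_odd' (n + 1) hk
  exact (surjective_map_of_lt hY hFhom hFirr ι hrange hkn).subsingleton

/-- **Odd cohomology above the middle vanishes**: `Hᵏ(X(ℂ); ℂ) = 0` for `k` odd, `n < k` (Poincaré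
duality `b_k = b_{2n−k}`, Hatcher Cor. 3.37, and the lower range; `Hᵏ = 0` for `k > 2n`).
[cite: HatcherAT2002, §3.3 Cor. 3.37] [cite: VoisinHodgeII2003, §1.2.3 Cor. 1.25] -/
theorem subsingleton_complexBetti_of_odd_of_gt (hX : IsSmoothProjective n X) (hf : f.IsHomogeneous d)
    (hf0 : f ≠ 0) (h : IsHypersurfaceCutOutBy (n + 1) f X) {k : ℕ} (hk : Odd k) (hnk : n < k) :
    Subsingleton (complexBetti X k) := by
  by_cases hk2 : k ≤ 2 * n
  · have hk1 := Nat.odd_iff.mp hk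
    have hodd : Odd (2 * n - k) := Nat.odd_iff.mpr (by omega)
    haveI := subsingleton_complexBetti_of_odd_of_lt hX hf hf0 h hodd (by omega)
    haveI := finite_complexBetti hX k
    have hfr := Motives.ComplexPoints.finrank_singularCohomology_eq_of_add_eq ℂ hX
      (p := k) (q := 2 * n - k) (by omega)
    have h0 : Module.finrank ℂ (complexBetti X (2 * n - k)) = 0 := Module.finrank_zero_of_subsingleton
    change Module.finrank ℂ (complexBetti X k) = Module.finrank ℂ (complexBetti X (2 * n - k)) at hfr
    rw [h0] at hfr
    exact Module.finrank_zero_iff.mp hfr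
  · exact Motives.ComplexPoints.subsingleton_singularCohomology_of_lt hX ℂ (k := k) (by omega)

/-- **`Hᵏ(X(ℂ); ℂ) = 0` for `k` odd, `k ≠ n`**, on a smooth projective `X` of dimension `n` cut out in
`ℙⁿ⁺¹_ℂ` by a non-zero form (Lefschetz below the middle, Poincaré duality above).
[cite: VoisinHodgeII2003, §1.2.2 Thm. 1.23 and §1.2.3 Cor. 1.25] -/
theorem subsingleton_complexBetti_of_odd (hX : IsSmoothProjective n X) (hf : f.IsHomogeneous d)
    (hf0 : f ≠ 0) (h : IsHypersurfaceCutOutBy (n + 1) f X) {k : ℕ} (hk : Odd k) (hkn : k ≠ n) :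
    Subsingleton (complexBetti X k) := by
  rcases Nat.lt_or_gt_of_ne hkn with hlt | hgt
  · exact subsingleton_complexBetti_of_odd_of_lt hX hf hf0 h hk hlt
  · exact subsingleton_complexBetti_of_odd_of_gt hX hf hf0 h hk hgt

/-- Rational cohomology vanishes where complex cohomology does (`ℂ ⊗_ℚ Hᵏ(X(ℂ); ℚ) ≅ Hᵏ(X(ℂ); ℂ)`,
the tree's `ofRatClassBaseChangeEquiv`; Voisin I §7.1.1). [cite: VoisinHodgeI2002, §7.1.1] -/
theorem subsingleton_bettiCohomology_of_subsingleton_complexBetti (hX : IsSmoothProjective n X) {k : ℕ}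
    [hk : Subsingleton (complexBetti X k)] : Subsingleton (bettiCohomology X k) := by
  haveI := BettiUniverse.finite hX k
  have h0 : Module.finrank ℂ (ℂ ⊗[ℚ] bettiCohomology X k) = 0 := by
    rw [(ofRatClassBaseChangeEquiv hX k).finrank_eq]
    exact Module.finrank_zero_of_subsingleton
  rw [Module.finrank_baseChange] at h0
  exact Module.finrank_zero_iff.mp h0

/-- **`Hᵏ(X(ℂ); ℚ) = 0` for `k` odd, `k ≠ n`** (rational form of `subsingleton_complexBetti_of_odd`).
[cite: VoisinHodgeII2003, §1.2.2 Thm. 1.23 and §1.2.3 Cor. 1.25] -/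
theorem subsingleton_bettiCohomology_of_odd (hX : IsSmoothProjective n X) (hf : f.IsHomogeneous d)
    (hf0 : f ≠ 0) (h : IsHypersurfaceCutOutBy (n + 1) f X) {k : ℕ} (hk : Odd k) (hkn : k ≠ n) :
    Subsingleton (bettiCohomology X k) := by
  haveI := subsingleton_complexBetti_of_odd hX hf hf0 h hk hkn
  exact subsingleton_bettiCohomology_of_subsingleton_complexBetti hX

/-! #### The threefold in `ℙ⁴` (crux K2 of `SignSymmetricPowers` / `CyclicUnitaryPowers`) -/

/-- **`H¹(X(ℂ); ℚ) = 0` and `H⁵(X(ℂ); ℚ) = 0` for a smooth projective threefold cut out in `ℙ⁴_ℂ`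
by a non-zero form** (so in the Künneth decomposition of its powers only `H⁰, H², H³, H⁴, H⁶`
occur). [cite: VoisinHodgeII2003, §1.2.2 Thm. 1.23 and §1.2.3 Cor. 1.25] -/
theorem subsingleton_bettiCohomology_one_and_five_threefold {X : SchemeOver ℂ}
    {f : MvPolynomial (Fin 5) ℂ} {d : ℕ} (hX : IsSmoothProjective 3 X) (hf : f.IsHomogeneous d)
    (hf0 : f ≠ 0) (h : IsHypersurfaceCutOutBy 4 f X) :
    Subsingleton (bettiCohomology X 1) ∧ Subsingleton (bettiCohomology X 5) :=
  ⟨subsingleton_bettiCohomology_of_odd (n := 3) hX hf hf0 h ⟨0, rfl⟩ (by omega),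
    subsingleton_bettiCohomology_of_odd (n := 3) hX hf hf0 h ⟨2, rfl⟩ (by omega)⟩

/-- **Every even-degree class on a smooth projective threefold cut out in `ℙ⁴_ℂ` by a non-zero form is
algebraic**: `algebraicClasses X p = ⊤` for every `p` (`2p ≠ 3`). In particular the Hodge conjecture
for `X` itself (`k = 0` of crux K2) is free. [cite: VoisinHodgeII2003, §1.2.3 Cor. 1.24 and Cor. 1.25] -/
theorem algebraicClasses_eq_top_threefold {X : SchemeOver ℂ} {f : MvPolynomial (Fin 5) ℂ} {d : ℕ}
    (hX : IsSmoothProjective 3 X) (hf : f.IsHomogeneous d) (hf0 : f ≠ 0)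
    (h : IsHypersurfaceCutOutBy 4 f X) (p : ℕ) : algebraicClasses X p = ⊤ :=
  algebraicClasses_eq_top_of_isHypersurfaceCutOutBy (n := 3) hX hf hf0 h (by omega)

end HodgeTheory

end Literature.AlgebraicGeometry.HodgeTheory

end
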